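import Mathlib.LinearAlgebra.Matrix.Adjugate            -- `Matrix.cramer_apply`, `Matrix.cramer_one`
import Mathlib.Data.Matrix.ColumnRowPartitioned          -- `Matrix.fromCols`
import Mathlib.Data.Matrix.Block                         -- `Matrix.fromBlocks`
import Mathlib.LinearAlgebra.Matrix.Determinant.Basic
import Mathlib.LinearAlgebra.Matrix.NonsingularInverse   -- `Matrix.inv_eq_left_inv`, `Matrix.inv_diagonal`
import Mathlib.LinearAlgebra.Matrix.GeneralLinearGroup.Defs   -- `GL`
import HarnessLib

/-!
# Crux `HLiu418`, Track B road `K2_Liu`, unit U5 «DOUBLING ZETA», socket #16 ∕ #16a (organ (IV-c)) — helper «F1»: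
# the maximal minors of `D · X` and of `[Y | 1]`, and the Siegel frame `S = [[1, 0], [1, 1]]` of the doubled space

Cell `hodgecm-mathlib`, crux item hLiu418 = `stmt-HodgeConjecture-24832`, route of record `HCCMUnconditional`; squad K2 ∕ K2Liu,
LEAD F0P6-plan (g10) 21:27:24Z («continue (IV-c) algebraic core»), prover K2Liu-p04 (g0), plan `K2/K2Liu-p04/g0/PLAN-16-DoublingHeightDecay.v1…md`
and DESIGN NOTE (K2/STATUS 21:28:54Z).  THEOREMS ONLY over an arbitrary commutative ring (pure Mathlib; no `def`, no instance, no notation,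
no `sorry`); lane `--supports stmt-HodgeConjecture-24832 --as helper` (count-neutral).

WHY.  The height of type `(P_Δ, |det_Δ|^{1∕2})` on the doubled group `H = U(𝕍 ⊕ −𝕍)` proposed as height of record for sockets #14a ∕ #16
is the PLÜCKER height `Φ₀(h) = H(π(h))^{-1∕2}`, `π(h)` = the vector of maximal minors of the bottom `n × 2n` block of `S⁻¹ h S` in the frame
`S = [[1, 0], [1, 1]]` (columns `(eᵢ, eᵢ)` spanning `Δ`, then `(0, eᵢ)`).  Its two structural facts are PURE MATRIX ALGEBRA, recorded here once
for every consumer ([GelbartPiatetskishapiroRallis1987, Part A §1]; [Kudla1994, §3]):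

* §1 MINORS.  `det_submatrix_mul` — a maximal minor of `D · X` is `det D` times the same minor of `X` (square `det_mul` only — no Cauchy–Binet);
  `det_submatrix_fromCols_one_inr` — the minor of `[Y | 1]` on the columns of `1` is `1`; `submatrix_fromCols_one_colSel`,
  `det_submatrix_fromCols_one_colSel` — the minor of `[Y | 1]` on «the columns of `1` with column `i` replaced by column `j` of `Y`» is `Y i j`
  (Cramer at the identity).  Hence the local Plücker height of `[Y | 1]` dominates `max(1, |Yᵢⱼ|)`.
* §2 THE FRAME `S` (= the tree's `E₂ = (1 0; 1 1)`, `E₁ = E₂⁻¹`: ★ `GRConstruction.E₂_mul_E₁ ∕ E₁_mul_E₂ ∕ conjE_eq ∕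
  blk_conj_eq_of_isSiegelDelta ∕ det_blk_eq_of_isSiegelDelta ∕ isUnit_detDelta_of_isSiegelDelta` in `DoubledUnitarySiegelParabolicAlgebra` —
  NOT restated here; a Siegel element conjugates to `[[h|_Δ, h₁₂], [0, h₂₂ − h₁₂]]`).  NEW here: `frameS_conj_diag` — the DOUBLING element
  `S⁻¹ diag(g, 1) S = [[g, 0], [1 − g, 1]]` (bottom block `[1 − g | 1]`, so §1 applies with `Y = 1 − g`); `submatrix_inr_fromBlocks` — the bottom
  row-block of `[[A, B], [C, D]]` is `[C | D]`; `submatrix_inr_mul_of_blockTriangular` — for `M = [[A′, B′], [0, D′]]`, bottom(`M N`) `= D′ ·`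
  bottom(`N`); `det_submatrix_bottom_mul_of_blockTriangular` — so every maximal minor of bottom(`M N`) is `det D′` times that of bottom(`N`)
  (the EXACT type property of `Φ₀`; with ★ `det_blk_eq_of_isSiegelDelta`, `|det D′| = |det_Δ|⁻¹` for unitary `M` downstream);
  `det_frameS_conj` — `det (S⁻¹ M S) = det M`; `doubling_bottom_minors` — the package used by #16a.
* §3 INVERSES.  `coe_inv_eq_of_unitary` — `g⁻¹ = J⁻¹ (σg)ᵀ J` when `(σg)ᵀ J g = J` and `det J` is a unit; `coe_inv_apply_of_unitary_diagonal` —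
  for `J = diag(d)` with `d′ d = 1`, `(g⁻¹)ᵢₖ = d′ᵢ σ(gₖᵢ) dₖ` (so the Borel–Jacquet height of `g ∈ U(diag d)` is controlled by the entries of `g` and `σg`).

HONEST LABEL.  Count-neutral algebra helper; the height itself (a `K2Lit` DEFS leaf), the decay #16a and the integrability #16b are separate files.
`HC_CM` is proved only modulo the 7 printed citations (2 remaining named inputs: hLiu418 = `stmt-HodgeConjecture-24832`, h413 =
`stmt-HodgeConjecture-24833`) until rung 0 closes.
-/

set_option autoImplicit false
-- the mandated namespace repeats the single-problem summit's segment (`HodgeConjecture.HodgeConjecture`)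
set_option linter.dupNamespace false

namespace Summit.HodgeConjecture.HodgeConjecture.Cruxes.HLiu418.K2LiuPluckerMinors

open scoped Matrix

/-! ## §1 Maximal minors of `D · X` and of `[Y | 1]` -/

/-- **A maximal minor of `D · X` is `det D` times the same minor of `X`** (column selection `f`; square `det_mul`).
[cite: GelbartPiatetskishapiroRallis1987, Part A §1] -/
theorem det_submatrix_mul {R : Type*} [CommRing R] {m κ : Type*} [Fintype m] [DecidableEq m]
    (D : Matrix m m R) (X : Matrix m κ R) (f : m → κ) :
    ((D * X).submatrix id f).det = D.det * (X.submatrix id f).det := by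
  rw [Matrix.submatrix_mul D X id id f Function.bijective_id, Matrix.submatrix_id_id, Matrix.det_mul]

/-- The minor of `[Y | 1]` on the columns of the identity block is the identity matrix. [folklore] -/
theorem submatrix_fromCols_one_inr {R : Type*} [CommRing R] {m : Type*} [DecidableEq m] (Y : Matrix m m R) :
    (Matrix.fromCols Y (1 : Matrix m m R)).submatrix id Sum.inr = 1 := by
  ext i j
  simp [Matrix.fromCols_apply_inr]

/-- **The minor of `[Y | 1]` on the columns of `1` is `1`.** [folklore] -/
theorem det_submatrix_fromCols_one_inr {R : Type*} [CommRing R] {m : Type*} [Fintype m] [DecidableEq m] (Y : Matrix m m R) :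
    ((Matrix.fromCols Y (1 : Matrix m m R)).submatrix id Sum.inr).det = 1 := by
  rw [submatrix_fromCols_one_inr, Matrix.det_one]

/-- The minor of `[Y | 1]` on «the columns of `1`, column `i` replaced by column `j` of `Y`» is the identity with column `i`
replaced by `Y_{·j}`. [folklore] -/
theorem submatrix_fromCols_one_colSel {R : Type*} [CommRing R] {m : Type*} [DecidableEq m] (Y : Matrix m m R) (i j : m) :
    (Matrix.fromCols Y (1 : Matrix m m R)).submatrix id (fun k => if k = i then Sum.inl j else Sum.inr k) =
      (1 : Matrix m m R).updateCol i (fun r => Y r j) := by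
  ext r k
  by_cases hk : k = i
  · subst hk
    simp [Matrix.updateCol_self, Matrix.fromCols_apply_inl]
  · simp [hk, Matrix.fromCols_apply_inr]

/-- **The minor of `[Y | 1]` on «the columns of `1`, column `i` replaced by column `j` of `Y`» equals `Y i j`** (Cramer's rule at
the identity matrix).  With `det_submatrix_fromCols_one_inr`: the maximal minors of `[Y | 1]` contain `1` and every entry of `Y`.
[cite: GelbartPiatetskishapiroRallis1987, Part A §1] -/
theorem det_submatrix_fromCols_one_colSel {R : Type*} [CommRing R] {m : Type*} [Fintype m] [DecidableEq m]
    (Y : Matrix m m R) (i j : m) :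
    ((Matrix.fromCols Y (1 : Matrix m m R)).submatrix id (fun k => if k = i then Sum.inl j else Sum.inr k)).det = Y i j := by
  rw [submatrix_fromCols_one_colSel, ← Matrix.cramer_apply, Matrix.cramer_one]
  rfl

/-! ## §2 The frame `S = [[1, 0], [1, 1]]` adapted to the diagonal `Δ = {(x, x)}` of `𝕍 ⊕ 𝕍` -/

/-- **The doubling element in the frame `S`**: `S⁻¹ diag(g, 1) S = [[g, 0], [1 − g, 1]]` — bottom block `[1 − g | 1]`.
[cite: GelbartPiatetskishapiroRallis1987, Part A §1] -/
theorem frameS_conj_diag {R : Type*} [CommRing R] {ι : Type*} [Fintype ι] [DecidableEq ι] (g : Matrix ι ι R) :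
    Matrix.fromBlocks (1 : Matrix ι ι R) (0 : Matrix ι ι R) (-1 : Matrix ι ι R) (1 : Matrix ι ι R) *
          Matrix.fromBlocks g (0 : Matrix ι ι R) (0 : Matrix ι ι R) (1 : Matrix ι ι R) *
        Matrix.fromBlocks (1 : Matrix ι ι R) (0 : Matrix ι ι R) (1 : Matrix ι ι R) (1 : Matrix ι ι R) =
      Matrix.fromBlocks g (0 : Matrix ι ι R) (1 - g) (1 : Matrix ι ι R) := by
  rw [Matrix.fromBlocks_multiply, Matrix.fromBlocks_multiply]
  congr 1
  · simp
  · simp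
  · simp only [Matrix.neg_mul, Matrix.one_mul, Matrix.mul_one, Matrix.mul_zero, add_zero]
    abel
  · simp

/-- `det (S⁻¹ M S) = det M`. [folklore] -/
theorem det_frameS_conj {R : Type*} [CommRing R] {ι : Type*} [Fintype ι] [DecidableEq ι] (M : Matrix (ι ⊕ ι) (ι ⊕ ι) R) :
    (Matrix.fromBlocks (1 : Matrix ι ι R) (0 : Matrix ι ι R) (-1 : Matrix ι ι R) (1 : Matrix ι ι R) * M *
        Matrix.fromBlocks (1 : Matrix ι ι R) (0 : Matrix ι ι R) (1 : Matrix ι ι R) (1 : Matrix ι ι R)).det = M.det := by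
  rw [Matrix.det_mul, Matrix.det_mul, Matrix.det_fromBlocks_zero₁₂, Matrix.det_fromBlocks_zero₁₂]
  simp

/-- The bottom row-block of `[[A, B], [C, D]]` is `[C | D]`. [folklore] -/
theorem submatrix_inr_fromBlocks {R : Type*} {ι : Type*} (A B C D : Matrix ι ι R) :
    (Matrix.fromBlocks A B C D).submatrix Sum.inr id = Matrix.fromCols C D := by
  ext i (j | j) <;> simp [Matrix.fromCols_apply_inl, Matrix.fromCols_apply_inr]

/-- **Bottom row-block of a product with a block-UPPER-triangular left factor**: for `M = [[A′, B′], [0, D′]]` and any `N`,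
bottom(`M N`) `= D′ ·` bottom(`N`). [cite: GelbartPiatetskishapiroRallis1987, Part A §1] -/
theorem submatrix_inr_mul_of_blockTriangular {R : Type*} [CommRing R] {ι κ : Type*} [Fintype ι]
    (A' B' D' : Matrix ι ι R) (N : Matrix (ι ⊕ ι) κ R) :
    (Matrix.fromBlocks A' B' 0 D' * N).submatrix Sum.inr id = D' * N.submatrix Sum.inr id := by
  ext i k
  simp [Matrix.mul_apply, Fintype.sum_sum_type, Matrix.fromBlocks_apply₂₁, Matrix.fromBlocks_apply₂₂]

/-- **THE TYPE PROPERTY OF THE PLÜCKER VECTOR**: for `M = [[A′, B′], [0, D′]]` (an element of the Siegel parabolic in the frame `S`) every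
maximal minor of bottom(`M N`) is `det D′` times the corresponding minor of bottom(`N`). [cite: GelbartPiatetskishapiroRallis1987, Part A §1] -/
theorem det_submatrix_bottom_mul_of_blockTriangular {R : Type*} [CommRing R] {ι : Type*} [Fintype ι] [DecidableEq ι] {κ : Type*}
    (A' B' D' : Matrix ι ι R) (N : Matrix (ι ⊕ ι) κ R) (f : ι → κ) :
    (((Matrix.fromBlocks A' B' 0 D' * N).submatrix Sum.inr id).submatrix id f).det =
      D'.det * ((N.submatrix Sum.inr id).submatrix id f).det := by
  rw [submatrix_inr_mul_of_blockTriangular, det_submatrix_mul]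

/-- **The doubling element's Plücker minors contain `1` and every entry of `1 − g`**: the bottom block of `S⁻¹ diag(g, 1) S` is
`[1 − g | 1]`, whose minor on the identity columns is `1` and whose minor on «identity columns with column `i` replaced by column `j` of
`1 − g`» is `(1 − g) i j`. [cite: GelbartPiatetskishapiroRallis1987, Part A §1] -/
theorem doubling_bottom_minors {R : Type*} [CommRing R] {ι : Type*} [Fintype ι] [DecidableEq ι] (g : Matrix ι ι R) (i j : ι) :
    (Matrix.fromBlocks (1 : Matrix ι ι R) (0 : Matrix ι ι R) (-1 : Matrix ι ι R) (1 : Matrix ι ι R) *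
          Matrix.fromBlocks g (0 : Matrix ι ι R) (0 : Matrix ι ι R) (1 : Matrix ι ι R) *
        Matrix.fromBlocks (1 : Matrix ι ι R) (0 : Matrix ι ι R) (1 : Matrix ι ι R) (1 : Matrix ι ι R)).submatrix Sum.inr id =
        Matrix.fromCols (1 - g) (1 : Matrix ι ι R) ∧
      (((Matrix.fromCols (1 - g) (1 : Matrix ι ι R)).submatrix id Sum.inr).det = 1 ∧
        ((Matrix.fromCols (1 - g) (1 : Matrix ι ι R)).submatrix id
          (fun k => if k = i then Sum.inl j else Sum.inr k)).det = (1 - g) i j) := by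
  refine ⟨?_, det_submatrix_fromCols_one_inr _, det_submatrix_fromCols_one_colSel _ i j⟩
  rw [frameS_conj_diag, submatrix_inr_fromBlocks]

/-! ## §3 Inverses in a unitary group: `g⁻¹ = J⁻¹ (σg)ᵀ J` (entries of `g⁻¹` are entries of `σg` up to the form) -/

/-- **`g⁻¹ = J⁻¹ · (σ g)ᵀ · J`** for an invertible matrix `g` with `(σ g)ᵀ J g = J` (membership in ★ `unitaryGroupOfForm σ J` unfolds to
this, ★ `mem_unitaryGroupOfForm_iff`) and `det J` a unit.  [cite: Rogawski1990, §1.9 p. 8] -/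
theorem coe_inv_eq_of_unitary {R : Type*} [CommRing R] {n : Type*} [Fintype n] [DecidableEq n] {σ : R →+* R}
    {J : Matrix n n R} (hJ : IsUnit J.det) {g : GL n R}
    (hg : ((g : Matrix n n R).map σ)ᵀ * J * (g : Matrix n n R) = J) :
    ((g⁻¹ : GL n R) : Matrix n n R) = J⁻¹ * ((g : Matrix n n R).map σ)ᵀ * J := by
  rw [Matrix.coe_units_inv]
  refine Matrix.inv_eq_left_inv ?_
  calc J⁻¹ * ((g : Matrix n n R).map σ)ᵀ * J * (g : Matrix n n R)
      = J⁻¹ * (((g : Matrix n n R).map σ)ᵀ * J * (g : Matrix n n R)) := by simp only [Matrix.mul_assoc]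
    _ = 1 := by rw [hg, Matrix.nonsing_inv_mul J hJ]

/-- **Entries of `g⁻¹` for a DIAGONAL form `J = diag(d)` with invertible entries** (`d′ᵢ dᵢ = 1`): `(g⁻¹)ᵢₖ = d′ᵢ · σ(gₖᵢ) · dₖ`.  So at every
place the entries of `g⁻¹` are bounded by those of `σ g` times constants depending only on `d` — the input of the comparison
`‖g‖_{BJ} ≤ C · H⁺(g) · H⁺(σ g)` in organ (IV-c). [cite: Rogawski1990, §1.9 p. 8] -/
theorem coe_inv_apply_of_unitary_diagonal {R : Type*} [CommRing R] {n : Type*} [Fintype n] [DecidableEq n] {σ : R →+* R}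
    {d d' : n → R} (hd : ∀ i, d' i * d i = 1) {g : GL n R}
    (hg : ((g : Matrix n n R).map σ)ᵀ * Matrix.diagonal d * (g : Matrix n n R) = Matrix.diagonal d) (i k : n) :
    ((g⁻¹ : GL n R) : Matrix n n R) i k = d' i * σ ((g : Matrix n n R) k i) * d k := by
  have hdd : Matrix.diagonal d' * Matrix.diagonal d = 1 := by
    rw [Matrix.diagonal_mul_diagonal, ← Matrix.diagonal_one]
    exact congrArg Matrix.diagonal (funext hd)
  have hinv : ((g⁻¹ : GL n R) : Matrix n n R) = Matrix.diagonal d' * ((g : Matrix n n R).map σ)ᵀ * Matrix.diagonal d := by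
    rw [Matrix.coe_units_inv]
    refine Matrix.inv_eq_left_inv ?_
    calc Matrix.diagonal d' * ((g : Matrix n n R).map σ)ᵀ * Matrix.diagonal d * (g : Matrix n n R)
        = Matrix.diagonal d' * (((g : Matrix n n R).map σ)ᵀ * Matrix.diagonal d * (g : Matrix n n R)) := by
          simp only [Matrix.mul_assoc]
      _ = 1 := by rw [hg, hdd]
  rw [hinv, Matrix.mul_diagonal, Matrix.diagonal_mul, Matrix.transpose_apply, Matrix.map_apply]

end Summit.HodgeConjecture.HodgeConjecture.Cruxes.HLiu418.K2LiuPluckerMinors
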